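import Mathlib
import Summits.Ventures.LatticeQCDFlow.Scoring.CalibrationTruths
import Summits.Ventures.LatticeQCDFlow.Scoring.BartlettKernel
import Summits.Ventures.LatticeQCDFlow.Scoring.MadrasSokalErrorFormula
import Summits.Ventures.LatticeQCDFlow.Scoring.MadrasSokalRatioVariance
import Summits.Ventures.LatticeQCDFlow.Scoring.MadrasSokalErrorFormulaGeometric
import Summits.Ventures.LatticeQCDFlow.Scoring.MadrasSokalWindowConstant
import HarnessLib

/-!
# The second-order Madras–Sokal constants on calibration set C-1: `V(W) − (4W+2)τ² → −3τ³ − 4τ² + τ + 3/(16τ)` and, for the ratio estimator, `R(W) − (4W+2)τ² → −9τ³ + τ + 1/(16τ)`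

HONEST FRAMING: exact (Metropolis-corrected) sampling algorithms for lattice gauge theory;
figures of merit are autocorrelation/cost numbers at stated couplings and volumes; no
continuum-physics claim.

Venture `LatticeQCDFlow` (cell pub-lqcd), sub-topic `Scoring`; FANOUT row 16 (`su2-base`), GEN-6.
NEW WORK of the cell over this packet (`MadrasSokalWindowConstant`: `V(W) − 4τ²W → windowConst`,
`R(W) − 4τ²W → windowConst + ratioLimit` under a first moment of `K`; `MadrasSokalErrorFormulaGeometric`:
`K(u) = r^u(u + (1+r²)/(1−r²))`, `ratioLimit = −6τ³ + 4τ² − 1/(8τ)` on C-1) and Mathlib's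
`hasSum_choose_mul_geometric_of_norm_lt_one` (`Σ C(n+k,k) rⁿ = (1−r)^{−k−1}`).  Nothing is cited as
a fact.  Printed counterparts, NAMED ONLY: Madras–Sokal 1988 (`(4W+2)τ²`); Wolff 2004 eq. (42)
(`(4W + 2 − 4τ)τ²`).

Eighth file of the ERROR-OF-THE-ERROR packet: everything in closed form on the cell's calibration
family C-1, `ρ(t) = r^t`, `0 ≤ r < 1`, `τ = τ_int = (1+r)/(2(1−r))`:

* `summable_moment_acfConv_geometric` — the first-moment hypothesis of `MadrasSokalWindowConstant`
  holds on C-1 (`(t+1) K(t+1) = (t+1)(t+1+q) r^{t+1}`, polynomial × geometric);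
* **`windowConst_geometric`** — `windowConst = −(2τ−1)(24τ³ + 28τ² + 6τ + 3)/(16τ)`
  (`= −[2r/(1−r)³ + q r (1/(1−r)² + 1/(1−r))]`, `q = (1+r²)/(1−r²)`; `≈ −3τ³`);
* **`tendsto_tauHatAVar_sub_printed_geometric`** — known normalisation:
  `V(W) − (4W+2)τ² → −3τ³ − 4τ² + τ + 3/(16τ)`;
* **`tendsto_tauHatRatioAVar_sub_printed_geometric`** — ratio estimator (linearised):
  `R(W) − (4W+2)τ² → −9τ³ + τ + 1/(16τ)` (`windowConst + ratioLimit − 2τ²`);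
  `ratio_printed_gap_neg` — this limit is `< 0` for every `τ ≥ ½`, and
  `eventually_tauHatRatioAVar_le_geometric`: for every `ε > 0`, eventually
  `R(W) ≤ (4W+2)τ² − 9τ³ + τ + 1/(16τ) + ε`.

* `natCast_mul_wolffDTau_sq` (`N δτ_A² = (4W+2)τ² − 4τ³`, scorer A's `CalibrationTruths.wolffDTau`),
  **`tendsto_tauHatRatioAVar_sub_wolff_geometric`** — `R(W) − N δτ_A² → −5τ³ + τ + 1/(16τ)`, and
  `wolff_gap_nonpos` — this is `≤ 0` for all `τ ≥ ½` (`= 0` iff `τ = ½`, independent data): in the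
  large-window Gaussian model on C-1 BOTH frozen scorers' bars over-cover the ratio estimator.

Reading (a REMARK, the theorems being asymptotic in `W` at fixed `τ`): at a self-consistent window
`W = cτ` the model variance is `≈ (4cτ + 2 − 9τ)τ²`, the fraction `≈ 1 − 9/(4c)` of the printed
`(4W+2)τ²`; at scorer B's `c = 6` that is `0.625` (direct evaluation: `0.632` at `τ = 19.5`;
Monte Carlo on AR(1) agrees), so the printed bar is `≈ 1.26 ×` the Gaussian-model standard
deviation of `τ̂_W` on C-1: row 16's '≤ 15 %' criterion judged with `δτ_B` is conservative there.
Wolff's `−4τ³` has the right sign and `4/9` of the magnitude.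

NOT CLAIMED: rates in `W`; the finite window as a theorem; the delta-method remainder; other
autocorrelation families (C-1b mixtures: the constants are not additive in the mixture).
-/

noncomputable section

open Finset Filter Topology

namespace Summit.Ventures.LatticeQCDFlow.Scoring

section Geometric

variable {r : ℝ}

/-- `K(t+1) = r^{t+1} (t + 1 + q)`, `q = (1+r²)/(1−r²)`, on C-1. -/
theorem acfConv_succ_geometric (h0 : 0 ≤ r) (h1 : r < 1) (t : ℕ) :
    acfConv (evenExt fun n => r ^ n) ((t : ℤ) + 1)
      = r ^ (t + 1) * ((t : ℝ) + 1 + (1 + r ^ 2) / (1 - r ^ 2)) := by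
  have := acfConv_geometric h0 h1 (t + 1)
  push_cast at this
  rw [this]

/-- `K(t+1) ≥ 0` on C-1 (indeed for every `r ≥ 0`). -/
theorem acfConv_succ_geometric_nonneg (h0 : 0 ≤ r) (t : ℕ) :
    0 ≤ acfConv (evenExt fun n => r ^ n) ((t : ℤ) + 1) :=
  acfConv_nonneg (fun _ => pow_nonneg h0 _) _

/-- **The first-moment hypothesis holds on C-1**: `Σ_t (t+1)|K(t+1)| < ∞`. -/
theorem summable_moment_acfConv_geometric (h0 : 0 ≤ r) (h1 : r < 1) :
    Summable fun t : ℕ => ((t : ℝ) + 1) * |acfConv (evenExt fun n => r ^ n) ((t : ℤ) + 1)| := by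
  have hr : ‖r‖ < 1 := by rw [Real.norm_eq_abs]; exact abs_lt_one_C1 h0 h1
  set q : ℝ := (1 + r ^ 2) / (1 - r ^ 2) with hq
  have h2 : Summable fun t : ℕ => ((t : ℝ) ^ 2 * r ^ t) := summable_pow_mul_geometric_of_norm_lt_one 2 hr
  have h1' : Summable fun t : ℕ => ((t : ℝ) ^ 1 * r ^ t) := summable_pow_mul_geometric_of_norm_lt_one 1 hr
  have h0' : Summable fun t : ℕ => r ^ t := summable_geometric_of_lt_one h0 h1
  have hs : Summable fun t : ℕ => r * (((t : ℝ) ^ 2 * r ^ t) + (2 + q) * ((t : ℝ) ^ 1 * r ^ t)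
      + (1 + q) * r ^ t) := ((h2.add (h1'.mul_left _)).add (h0'.mul_left _)).mul_left r
  refine hs.congr fun t => ?_
  rw [abs_of_nonneg (acfConv_succ_geometric_nonneg h0 t), acfConv_succ_geometric h0 h1, ← hq,
    pow_succ]
  ring

/-! ## The window constant in closed form -/

/-- `Σ_t (t+1)(t+2) r^t = 2/(1−r)³` (`|r| < 1`). -/
theorem hasSum_succ_mul_succ_succ_mul_geometric (hr : ‖r‖ < 1) :
    HasSum (fun t : ℕ => ((t : ℝ) + 1) * ((t : ℝ) + 2) * r ^ t) (2 / (1 - r) ^ 3) := by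
  have h := (hasSum_choose_mul_geometric_of_norm_lt_one 2 hr).mul_left 2
  have hval : (2 : ℝ) * (1 / (1 - r) ^ (2 + 1)) = 2 / (1 - r) ^ 3 := by ring
  rw [hval] at h
  refine h.congr_fun fun t => ?_
  rw [Nat.cast_choose_two]
  push_cast
  ring

/-- `Σ_t (t+2) r^t = 1/(1−r)² + 1/(1−r)` (`|r| < 1`). -/
theorem hasSum_succ_succ_mul_geometric (hr : ‖r‖ < 1) :
    HasSum (fun t : ℕ => ((t : ℝ) + 2) * r ^ t) (1 / (1 - r) ^ 2 + 1 / (1 - r)) := by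
  have h1 := hasSum_choose_mul_geometric_of_norm_lt_one 1 hr
  have h0 : HasSum (fun t : ℕ => r ^ t) (1 / (1 - r)) := by
    have := hasSum_geometric_of_norm_lt_one hr
    simpa [one_div] using this
  refine (h1.add h0).congr_fun fun t => ?_
  simp only [Nat.choose_one_right]
  push_cast
  ring

/-- **The window constant on C-1 in `r`**:
`windowConst = −(2r/(1−r)³ + q r (1/(1−r)² + 1/(1−r)))`, `q = (1+r²)/(1−r²)`. -/
theorem windowConst_geometric_r (h0 : 0 ≤ r) (h1 : r < 1) :
    windowConst (fun n => r ^ n)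
      = -(2 * r / (1 - r) ^ 3
          + (1 + r ^ 2) / (1 - r ^ 2) * r * (1 / (1 - r) ^ 2 + 1 / (1 - r))) := by
  have hr : ‖r‖ < 1 := by rw [Real.norm_eq_abs]; exact abs_lt_one_C1 h0 h1
  set q : ℝ := (1 + r ^ 2) / (1 - r ^ 2) with hq
  have hA := (hasSum_succ_mul_succ_succ_mul_geometric hr).mul_left r
  have hB := (hasSum_succ_succ_mul_geometric hr).mul_left (q * r)
  have hsum : HasSum (fun t : ℕ => ((t : ℝ) + 2) * acfConv (evenExt fun n => r ^ n) ((t : ℤ) + 1))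
      (r * (2 / (1 - r) ^ 3) + q * r * (1 / (1 - r) ^ 2 + 1 / (1 - r))) := by
    refine (hA.add hB).congr_fun fun t => ?_
    rw [acfConv_succ_geometric h0 h1, ← hq, pow_succ]
    ring
  rw [windowConst, hsum.tsum_eq]
  ring

/-- **The window constant on C-1 in `τ`**: `windowConst = −(2τ−1)(24τ³ + 28τ² + 6τ + 3)/(16τ)`,
`τ = τ_int = (1+r)/(2(1−r))`. -/
theorem windowConst_geometric (h0 : 0 ≤ r) (h1 : r < 1) :
    windowConst (fun n => r ^ n)
      = -(2 * tauInt (fun n => r ^ n) - 1)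
          * (24 * tauInt (fun n => r ^ n) ^ 3 + 28 * tauInt (fun n => r ^ n) ^ 2
            + 6 * tauInt (fun n => r ^ n) + 3) / (16 * tauInt (fun n => r ^ n)) := by
  rw [windowConst_geometric_r h0 h1, tauInt_geometric (abs_lt_one_C1 h0 h1)]
  have h1r : (1 : ℝ) - r ≠ 0 := by linarith
  have h1r' : (1 : ℝ) + r ≠ 0 := by linarith
  have h1r2 : (1 : ℝ) - r ^ 2 ≠ 0 := by
    have : r ^ 2 < 1 := by nlinarith
    linarith
  field_simp
  ring

/-! ## The constants against the printed `(4W + 2) τ²` -/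

/-- **Known normalisation on C-1**: `V(W) − (4W+2)τ² → −3τ³ − 4τ² + τ + 3/(16τ)`. -/
theorem tendsto_tauHatAVar_sub_printed_geometric (h0 : 0 ≤ r) (h1 : r < 1) :
    Tendsto (fun W : ℕ => tauHatAVar (fun n => r ^ n) W - (4 * W + 2) * tauInt (fun n => r ^ n) ^ 2)
      atTop (𝓝 (-3 * tauInt (fun n => r ^ n) ^ 3 - 4 * tauInt (fun n => r ^ n) ^ 2
        + tauInt (fun n => r ^ n) + 3 / (16 * tauInt (fun n => r ^ n)))) := by
  have hρs : Summable fun n : ℕ => r ^ n := summable_geometric_C1 h0 h1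
  have hτ := tauInt_geometric_pos h0 h1
  have hlim := (tendsto_tauHatAVar_sub_lin hρs (pow_zero r)
    (summable_moment_acfConv_geometric h0 h1)).sub_const (2 * tauInt (fun n => r ^ n) ^ 2)
  have hval : windowConst (fun n => r ^ n) - 2 * tauInt (fun n => r ^ n) ^ 2
      = -3 * tauInt (fun n => r ^ n) ^ 3 - 4 * tauInt (fun n => r ^ n) ^ 2
        + tauInt (fun n => r ^ n) + 3 / (16 * tauInt (fun n => r ^ n)) := by
    rw [windowConst_geometric h0 h1]
    field_simp
    ring
  rw [← hval]
  refine hlim.congr fun W => ?_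
  ring

/-- **Ratio estimator on C-1**: `R(W) − (4W+2)τ² → −9τ³ + τ + 1/(16τ)`. -/
theorem tendsto_tauHatRatioAVar_sub_printed_geometric (h0 : 0 ≤ r) (h1 : r < 1) :
    Tendsto (fun W : ℕ => tauHatRatioAVar (fun n => r ^ n) W
        - (4 * W + 2) * tauInt (fun n => r ^ n) ^ 2)
      atTop (𝓝 (-9 * tauInt (fun n => r ^ n) ^ 3 + tauInt (fun n => r ^ n)
        + 1 / (16 * tauInt (fun n => r ^ n)))) := by
  have hρs : Summable fun n : ℕ => r ^ n := summable_geometric_C1 h0 h1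
  have hτ := tauInt_geometric_pos h0 h1
  have hlim := (tendsto_tauHatRatioAVar_sub_lin hρs (pow_zero r)
    (summable_moment_acfConv_geometric h0 h1)).sub_const (2 * tauInt (fun n => r ^ n) ^ 2)
  have hval : windowConst (fun n => r ^ n) + ratioLimit (fun n => r ^ n)
        - 2 * tauInt (fun n => r ^ n) ^ 2
      = -9 * tauInt (fun n => r ^ n) ^ 3 + tauInt (fun n => r ^ n)
        + 1 / (16 * tauInt (fun n => r ^ n)) := by
    rw [windowConst_geometric h0 h1, ratioLimit_geometric h0 h1]
    field_simp
    ring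
  rw [← hval]
  refine hlim.congr fun W => ?_
  ring

/-- The ratio-estimator gap is negative for every `τ ≥ ½`: `−9τ³ + τ + 1/(16τ) < 0`. -/
theorem ratio_printed_gap_neg (h0 : 0 ≤ r) (h1 : r < 1) :
    -9 * tauInt (fun n => r ^ n) ^ 3 + tauInt (fun n => r ^ n)
        + 1 / (16 * tauInt (fun n => r ^ n)) < 0 := by
  set τ := tauInt (fun n => r ^ n) with hτ_def
  have hτ : 0 < τ := tauInt_geometric_pos h0 h1
  have hτ2 : 1 / 2 ≤ τ := half_le_tauInt_geometric h0 h1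
  have key : -9 * τ ^ 3 + τ + 1 / (16 * τ) = (-(144 * τ ^ 4) + 16 * τ ^ 2 + 1) / (16 * τ) := by
    field_simp
    ring
  have hτsq : 1 / 4 ≤ τ ^ 2 := by nlinarith
  have h4 : 36 * τ ^ 2 ≤ 144 * τ ^ 4 := by nlinarith [mul_le_mul_of_nonneg_left hτsq (by positivity : (0 : ℝ) ≤ 144 * τ ^ 2)]
  rw [key, div_neg_iff]
  right
  refine ⟨by nlinarith, by positivity⟩

/-- Hence on C-1, for every `ε > 0`: eventually `R(W) ≤ (4W+2)τ² − 9τ³ + τ + 1/(16τ) + ε`. -/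
theorem eventually_tauHatRatioAVar_le_geometric (h0 : 0 ≤ r) (h1 : r < 1) {ε : ℝ} (hε : 0 < ε) :
    ∀ᶠ W : ℕ in atTop, tauHatRatioAVar (fun n => r ^ n) W
      ≤ (4 * W + 2) * tauInt (fun n => r ^ n) ^ 2
        + (-9 * tauInt (fun n => r ^ n) ^ 3 + tauInt (fun n => r ^ n)
          + 1 / (16 * tauInt (fun n => r ^ n))) + ε := by
  have h := tendsto_tauHatRatioAVar_sub_printed_geometric h0 h1
  have hev := h.eventually (Iic_mem_nhds (lt_add_of_pos_right _ hε))
  filter_upwards [hev] with W hW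
  have hW' : tauHatRatioAVar (fun n => r ^ n) W - (4 * W + 2) * tauInt (fun n => r ^ n) ^ 2
      ≤ -9 * tauInt (fun n => r ^ n) ^ 3 + tauInt (fun n => r ^ n)
          + 1 / (16 * tauInt (fun n => r ^ n)) + ε := hW
  linarith

/-! ## Against Wolff's bar `δτ_A = 2τ √((W + ½ − τ)/N)` (scorer A) -/

/-- Wolff's bar in the variance scale: `N · δτ_A² = (4W + 2)τ² − 4τ³` (`CalibrationTruths.wolffDTau`),
for `N > 0` and `W + ½ ≥ τ` (the radicand is non-negative). -/
theorem natCast_mul_wolffDTau_sq {τ W N : ℝ} (hW : τ ≤ W + 1 / 2) (hN : 0 < N) :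
    N * wolffDTau τ W N ^ 2 = (4 * W + 2) * τ ^ 2 - 4 * τ ^ 3 := by
  unfold wolffDTau
  rw [mul_pow, Real.sq_sqrt (div_nonneg (by linarith) hN.le)]
  field_simp
  ring

/-- **Ratio estimator on C-1 against Wolff's bar**: `R(W) − N δτ_A² → −5τ³ + τ + 1/(16τ)` as
`W → ∞`, at any fixed `N > 0`. -/
theorem tendsto_tauHatRatioAVar_sub_wolff_geometric (h0 : 0 ≤ r) (h1 : r < 1) {N : ℝ} (hN : 0 < N) :
    Tendsto (fun W : ℕ => tauHatRatioAVar (fun n => r ^ n) W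
        - N * wolffDTau (tauInt (fun n => r ^ n)) W N ^ 2)
      atTop (𝓝 (-5 * tauInt (fun n => r ^ n) ^ 3 + tauInt (fun n => r ^ n)
        + 1 / (16 * tauInt (fun n => r ^ n)))) := by
  set τ := tauInt (fun n => r ^ n) with hτ_def
  have h := (tendsto_tauHatRatioAVar_sub_printed_geometric h0 h1).add_const (4 * τ ^ 3)
  have hval : -9 * τ ^ 3 + τ + 1 / (16 * τ) + 4 * τ ^ 3 = -5 * τ ^ 3 + τ + 1 / (16 * τ) := by ring
  rw [hval] at h
  refine h.congr' ?_
  obtain ⟨W₀, hW₀⟩ := exists_nat_ge τ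
  filter_upwards [eventually_ge_atTop W₀] with W hW
  have hWτ : τ ≤ (W : ℝ) + 1 / 2 := by
    have : (W₀ : ℝ) ≤ W := by exact_mod_cast hW
    linarith
  rw [natCast_mul_wolffDTau_sq hWτ hN]
  ring

/-- The Wolff gap `−5τ³ + τ + 1/(16τ)` is `≤ 0` for every `τ ≥ ½`, with equality exactly at
`τ = ½` (`r = 0`, independent data): on C-1 even scorer A's smaller bar over-covers the
Gaussian-model variance of the ratio estimator in the large-window limit. -/
theorem wolff_gap_nonpos (h0 : 0 ≤ r) (h1 : r < 1) :
    -5 * tauInt (fun n => r ^ n) ^ 3 + tauInt (fun n => r ^ n)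
        + 1 / (16 * tauInt (fun n => r ^ n)) ≤ 0 := by
  set τ := tauInt (fun n => r ^ n) with hτ_def
  have hτ : 0 < τ := tauInt_geometric_pos h0 h1
  have hτ2 : 1 / 2 ≤ τ := half_le_tauInt_geometric h0 h1
  have key : -5 * τ ^ 3 + τ + 1 / (16 * τ) = -((80 * τ ^ 4 - 16 * τ ^ 2 - 1) / (16 * τ)) := by
    field_simp
    ring
  rw [key, neg_nonpos]
  refine div_nonneg ?_ (by positivity)
  have hτsq : 1 / 4 ≤ τ ^ 2 := by nlinarith
  nlinarith [mul_le_mul_of_nonneg_left hτsq (by positivity : (0 : ℝ) ≤ 80 * τ ^ 2)]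

end Geometric

end Summit.Ventures.LatticeQCDFlow.Scoring
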